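import Summits.HodgeConjecture.CorCM.D2Bridge.ClosedPrintedMuKeyIdentLemD3DelRecConjOmegaT
import Summits.HodgeConjecture.CorCM.D2Bridge.IndexOfRecordNonempty
import Summits.HodgeConjecture.CorCM.D2Bridge.AdapterMuConjLegs
import Summits.HodgeConjecture.CorCM.HypLiu418.A3Liu418BettiThetaOfProp413
import HarnessLib

/-!
# Line `a3-liu418`, stub P — the THETA HALF AT THE PIN: `BettiThetaDecomposition` of the pin's tower from the binder `Hyp413`

Cell `hodgecm-mathlib`, fan A, rung A-III; Summits lane `CorCM/HypLiu418/`; seat A-p06 (RULING (P) 2026-08-28T02:22:42Z).  For the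
face `(hDel, F, ι₁, V, a, Φ)` of the registered stub `stub_bettiThetaModel` (skeleton `A-plan/lines/a3-liu418.lean` v3 sha16
1b96ade3f8b6b529 :523/:662) the uniform family is `muConj 𝕌_V` at `a` (`UV hDel F V a Φ`, :454) and the natural tower module is THE
PIN's `H = (liuDictionaryPin … V I line).H` (`TowerCarrier.Tower`), the very module at which the headline binder `Hyp413`
([Liu2021] Prop. 4.13 AS PRINTED, pack decl `PrintedCitationHypotheses.Hyp413`, PrintedCitationHypothesesT.lean :85–88) is stated.
`bettiThetaDecomposition_pin_of_hyp413`: from `Hyp413` (taken as a hypothesis, its body VERBATIM), at every such face with `ι₁ ∈ Φ`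
(`hΦ`, as in `Hyp413`) and `ι₁` the chosen embedding of its place (`hemb`, which makes the index of record non-empty over the class of
`a`: `exists_indexOfRecord_fst_eq`, `repAt_fst_eq_of_fst_eq_mk`), the pin's tower with its `ℂ[𝔾(𝔸_F^∞)]`-module structure decomposes as
`⊕ ω(μ,ε,χ)` over all labelled admissible triples of `muConj 𝕌_V` at `a` — `Hyp413` at the index over `⟦a⟧`, the `μ ↦ μᶜ`
relabelling `AdapterMuConj.prop413AsPrinted_muConj`, and `bettiThetaDecomposition_of_prop413AsPrinted`.  This is the theta half of the
junction `stub_bettiThetaModel_of_hyp413`; the pinning half (the pin's tower ↔ the Albanese Betti levels of the canonical model, B3-01)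
is separate.  Nothing is asserted unconditionally (hypothesis `h413`); HC_CM is proved only modulo the 7 printed citations until rung 0
closes.

## References
* [Liu2021] Prop. 4.13 (FJcycle.tex l. 2110–2131), Def. 4.11–4.12, Rem. 4.4, Thm. 4.18 proof l. 2254–2257.
-/

set_option autoImplicit false

noncomputable section

namespace Summit.HodgeConjecture.CorCM.Lines.A3Liu418

open scoped TensorProduct Matrix
open NumberField NumberField.InfinitePlace
open HodgeCM.Model HodgeCM.Model.LiuIndex HodgeCM.Model.TowerCarrier
open HodgeCM.Literature.Theta.LiuAlbaneseModuleDatum.D2Bridge (HcmPieces)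
open Summit.HodgeConjecture.CorCM.Model
open Literature.AlgebraicGeometry.Motives (CMType)
open Literature.AlgebraicGeometry.HodgeTheory Literature.NumberTheory.Automorphic.PicardCM
open Literature.AlgebraicGeometry.ShimuraVarieties.UnitaryCanonicalModel
open Literature.NumberTheory.ComplexMultiplication
open Literature.NumberTheory.Automorphic
open Literature.NumberTheory.Automorphic.IdeleClassGroup (toHeckeCharacter isUnitary_toHeckeCharacter galConj)
open Literature.NumberTheory.Automorphic.Liu2021 Literature.NumberTheory.Automorphic.Liu2021.AppendixC
open Literature.NumberTheory.Automorphic.Liu2021.AppendixC.RestOne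
open Literature.NumberTheory.Automorphic.Liu2021.Def411WeilCarriers (lineOf locF Rep)
open Summit.HodgeConjecture.CorCM.Transposition.OmegaTransport (realUnit)
open HodgeCM.Model.ArchSideTerm (e₁)
open Literature.NumberTheory.GelbartRogawski1991 Literature.NumberTheory.GelbartRogawski1991.UnitaryDualPair
open Literature.NumberTheory.GelbartRogawski1991.UnitaryDualPair.LocalSplitting (localMu norm_localMu continuous_localMu localMu_toLocalRing_eq_one_iff
  eq_of_forall_localMu_toHeckeCharacter_eq)
open Literature.RepresentationTheory Literature.RepresentationTheory.Liu2021
open Summit.HodgeConjecture.CorCM.Transposition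
open Summit.HodgeConjecture.CorCM.D2Bridge.AdapterMuConj (muConj prop413AsPrinted_muConj def411_muConj nontrivial_omegaAt_muConj_rest)
open Summit.HodgeConjecture.CorCM.D2Bridge.MuKeyIdentEnd (hc_cm_of_printed_citations_muKey_ident)
open Summit.HodgeConjecture.CorCM.D2Bridge.MuKeyIdentLemD3End
open Summit.HodgeConjecture.CorCM.D2Bridge.MuKeyIdentLemD3DelRecConjOmegaEnd (diagonal_frameD_map_complexConj)

open Summit.HodgeConjecture.CorCM.D2Bridge.MuKeyIdentLemD3DelRecConjOmegaEndT (hc_cm_of_printed_citations_muKey_ident_lemD3_delRecConjOmegaT)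
open scoped DirectSum

open Summit.HodgeConjecture.CorCM.Transposition.CentralTypeAtPin (exists_indexOfRecord_fst_eq repAt_fst_eq_of_fst_eq_mk)

/-- **The theta half of stub P at the pin**: `Hyp413` (its body, verbatim, as the hypothesis `h413`) ⟹ for every face
`(hDel, F, ι₁, V, a, Φ)` with `ι₁ ∈ Φ` and `ι₁` the chosen embedding of its place, the pin's tower module
`(liuDictionaryPin … V (I V (repAt a) _) (line V (repAt a) _)).H` with its `ℂ[𝔾(𝔸_F^∞)]`-action decomposes equivariantly as the direct
sum of the `ω(μ, ε, χ)` over all labelled admissible triples of `muConj 𝕌_V` at `a` (`BettiThetaDecomposition`, the conjunct of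
`StubBettiThetaModel`).  Proof: the index of record has an element `i` over `⟦a⟧` with `repAt a i.1 = a` (`exists_indexOfRecord_fst_eq`,
`repAt_fst_eq_of_fst_eq_mk`); `Hyp413` there is [Prop 4.13] for `𝕌_V` at `repAt a i.1`, transported to `a` by substituting a FREE
scalar (no dependent rewriting of the face term); relabel `μ ↦ μᶜ` (`prop413AsPrinted_muConj`); re-index
(`bettiThetaDecomposition_of_prop413AsPrinted`, `n = 3`). [cite: Liu2021, Prop. 4.13 (FJcycle.tex l. 2110–2131); Rem. 4.4; Def. 4.12] -/
theorem bettiThetaDecomposition_pin_of_hyp413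
    (h413 :
      ∀ (hDel : Literature.AlgebraicGeometry.ShimuraVarieties.UnitaryCanonicalModel.canonicalModel_exists_printed),
      ∀ (F : HodgeCM.CMField) [IsGalois ℚ F] (h6 : 6 ≤ Module.finrank ℚ F) {ι₁ : F →+* ℂ} (V : HodgeCM.HermSpace3 F ι₁) (a₀ : RealScalar F)
      (Φ : CMType F) (hΦ : ι₁ ∈ Φ.1) (i : (I V (repAt a₀) (muLiu ι₁ GramClass.rep))), Prop413AsPrinted (((uniformOmegaRep (Summit.HodgeConjecture.CorCM.DelRec.exists_recordSystem_of_printed hDel) ⟨HodgeCM.CMField.K F⟩ ι₁ ⟨HodgeCM.HermSpace3.Hm V, HodgeCM.HermSpace3.isHermitian V, HodgeCM.HermSpace3.signature_ι₁ V, HodgeCM.HermSpace3.posDef_of_ne V⟩ Φ e₁ (frameD V) (frameD_real V) (frameD_ne V) (ιVE V) (2 * imagUnit (HodgeCM.CMField.K F))⁻¹ (fun _ _ => (Rep.update ↥(maximalRealSubfield (HodgeCM.CMField.K F)) (imagUnitSq (HodgeCM.CMField.K F)) (Rep.ofLineOf ↥(maximalRealSubfield (HodgeCM.CMField.K F)) (imagUnitSq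 (HodgeCM.CMField.K F))) (locF ↥(maximalRealSubfield (HodgeCM.CMField.K F)) (imagUnitSq (HodgeCM.CMField.K F)) (realUnit ⟨HodgeCM.CMField.K F⟩ (repAt a₀ (Sigma.fst i)).1 (repAt a₀ (Sigma.fst i)).2.1 (repAt a₀ (Sigma.fst i)).2.2)) (realUnit ⟨HodgeCM.CMField.K F⟩ (repAt a₀ (Sigma.fst i)).1 (repAt a₀ (Sigma.fst i)).2.1 (repAt a₀ (Sigma.fst i)).2.2) rfl)))).prop413Data ((liuDictionaryPin exists_isReal_hodgeModel_holds hodgePQ_independent_of_hodgeModel_holds BallQuotient.ballQuotientUniformised_holds (cmAbelianVarietyRealised_of_eigenbasis exists_isReal_hodgeModel_holds hodgePQ_independent_of_hodgeModel_holds cmAbelianVarietyEigenbasisRealised_holds) Literature.NumberTheory.Transcendental.arapura2012_cor_15_4_6_holds V (I V (repAt a₀) (muLiu ι₁ GramClass.rep)) (line V (repAt a₀) (muLiu ι₁ GramClass.rep)))).H)) :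
    ∀ (hDel : Literature.AlgebraicGeometry.ShimuraVarieties.UnitaryCanonicalModel.canonicalModel_exists_printed)
      (F : HodgeCM.CMField) [IsGalois ℚ F] (h6 : 6 ≤ Module.finrank ℚ F) {ι₁ : F →+* ℂ} (V : HodgeCM.HermSpace3 F ι₁)
      (hemb : (NumberField.InfinitePlace.mk ι₁).embedding = ι₁) (a : RealScalar F) (Φ : CMType F) (hΦ : ι₁ ∈ Φ.1),
      BettiThetaDecomposition
        (Summit.HodgeConjecture.CorCM.D2Bridge.AdapterMuConj.muConj (uniformOmegaRep (Summit.HodgeConjecture.CorCM.DelRec.exists_recordSystem_of_printed hDel) ⟨HodgeCM.CMField.K F⟩ ι₁ ⟨HodgeCM.HermSpace3.Hm V, HodgeCM.HermSpace3.isHermitian V, HodgeCM.HermSpace3.signature_ι₁ V, HodgeCM.HermSpace3.posDef_of_ne V⟩ Φ e₁ (frameD V) (frameD_real V) (frameD_ne V) (ιVE V) (2 * imagUnit (HodgeCM.CMField.K F))⁻¹ (fun _ _ => (Rep.update ↥(maximalRealSubfield (HodgeCM.CMField.K F)) (imagUnitSq (HodgeCM.CMField.K F)) (Rep.ofLineOf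 ↥(maximalRealSubfield (HodgeCM.CMField.K F)) (imagUnitSq (HodgeCM.CMField.K F))) (locF ↥(maximalRealSubfield (HodgeCM.CMField.K F)) (imagUnitSq (HodgeCM.CMField.K F)) (realUnit ⟨HodgeCM.CMField.K F⟩ a.1 a.2.1 a.2.2)) (realUnit ⟨HodgeCM.CMField.K F⟩ a.1 a.2.1 a.2.2) rfl))))
        ((liuDictionaryPin exists_isReal_hodgeModel_holds hodgePQ_independent_of_hodgeModel_holds BallQuotient.ballQuotientUniformised_holds (cmAbelianVarietyRealised_of_eigenbasis exists_isReal_hodgeModel_holds hodgePQ_independent_of_hodgeModel_holds cmAbelianVarietyEigenbasisRealised_holds) Literature.NumberTheory.Transcendental.arapura2012_cor_15_4_6_holds V (I V (repAt a) (muLiu ι₁ GramClass.rep)) (line V (repAt a) (muLiu ι₁ GramClass.rep)))).H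
        (Representation.ofModule' (k := ℂ) ((liuDictionaryPin exists_isReal_hodgeModel_holds hodgePQ_independent_of_hodgeModel_holds BallQuotient.ballQuotientUniformised_holds (cmAbelianVarietyRealised_of_eigenbasis exists_isReal_hodgeModel_holds hodgePQ_independent_of_hodgeModel_holds cmAbelianVarietyEigenbasisRealised_holds) Literature.NumberTheory.Transcendental.arapura2012_cor_15_4_6_holds V (I V (repAt a) (muLiu ι₁ GramClass.rep)) (line V (repAt a) (muLiu ι₁ GramClass.rep)))).H) := by
  intro hDel F _ h6 ι₁ V hemb a Φ hΦ
  -- the index of record has an element over `⟦a⟧`, and there `repAt a _ = a`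
  obtain ⟨i, hi⟩ := exists_indexOfRecord_fst_eq V a hemb (GramClass.mk a)
  -- transport along `repAt a i.1 = a` by substitution of a FREE scalar `b` (no dependent rewriting of the face term)
  have main : ∀ (b : RealScalar F), b = a →
      Prop413AsPrinted (((uniformOmegaRep (Summit.HodgeConjecture.CorCM.DelRec.exists_recordSystem_of_printed hDel) ⟨HodgeCM.CMField.K F⟩ ι₁ ⟨HodgeCM.HermSpace3.Hm V, HodgeCM.HermSpace3.isHermitian V, HodgeCM.HermSpace3.signature_ι₁ V, HodgeCM.HermSpace3.posDef_of_ne V⟩ Φ e₁ (frameD V) (frameD_real V) (frameD_ne V) (ιVE V) (2 * imagUnit (HodgeCM.CMField.K F))⁻¹ (fun _ _ => (Rep.update ↥(maximalRealSubfield (HodgeCM.CMField.K F)) (imagUnitSq (HodgeCM.CMField.K F)) (Rep.ofLineOf ↥(maximalRealSubfield (HodgeCM.CMField.K F)) (imagUnitSq (HodgeCM.CMField.K F))) (locF ↥(maximalRealSubfield (HodgeCM.CMField.K F)) (imagUnitSq (HodgeCM.CMField.K F)) (realUnit ⟨HodgeCM.CMField.K F⟩ b.1 b.2.1 b.2.2))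 (realUnit ⟨HodgeCM.CMField.K F⟩ b.1 b.2.1 b.2.2) rfl)))).prop413Data (((liuDictionaryPin exists_isReal_hodgeModel_holds hodgePQ_independent_of_hodgeModel_holds BallQuotient.ballQuotientUniformised_holds (cmAbelianVarietyRealised_of_eigenbasis exists_isReal_hodgeModel_holds hodgePQ_independent_of_hodgeModel_holds cmAbelianVarietyEigenbasisRealised_holds) Literature.NumberTheory.Transcendental.arapura2012_cor_15_4_6_holds V (I V (repAt a) (muLiu ι₁ GramClass.rep)) (line V (repAt a) (muLiu ι₁ GramClass.rep)))).H)) →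
      BettiThetaDecomposition
        (Summit.HodgeConjecture.CorCM.D2Bridge.AdapterMuConj.muConj (uniformOmegaRep (Summit.HodgeConjecture.CorCM.DelRec.exists_recordSystem_of_printed hDel) ⟨HodgeCM.CMField.K F⟩ ι₁ ⟨HodgeCM.HermSpace3.Hm V, HodgeCM.HermSpace3.isHermitian V, HodgeCM.HermSpace3.signature_ι₁ V, HodgeCM.HermSpace3.posDef_of_ne V⟩ Φ e₁ (frameD V) (frameD_real V) (frameD_ne V) (ιVE V) (2 * imagUnit (HodgeCM.CMField.K F))⁻¹ (fun _ _ => (Rep.update ↥(maximalRealSubfield (HodgeCM.CMField.K F)) (imagUnitSq (HodgeCM.CMField.K F)) (Rep.ofLineOf ↥(maximalRealSubfield (HodgeCM.CMField.K F)) (imagUnitSq (HodgeCM.CMField.K F))) (locF ↥(maximalRealSubfield (HodgeCM.CMField.K F)) (imagUnitSq (HodgeCM.CMField.K F)) (realUnit ⟨HodgeCM.CMField.K F⟩ a.1 a.2.1 a.2.2)) (realUnit ⟨HodgeCM.CMField.K F⟩ a.1 a.2.1 a.2.2) rfl))))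
        ((liuDictionaryPin exists_isReal_hodgeModel_holds hodgePQ_independent_of_hodgeModel_holds BallQuotient.ballQuotientUniformised_holds (cmAbelianVarietyRealised_of_eigenbasis exists_isReal_hodgeModel_holds hodgePQ_independent_of_hodgeModel_holds cmAbelianVarietyEigenbasisRealised_holds) Literature.NumberTheory.Transcendental.arapura2012_cor_15_4_6_holds V (I V (repAt a) (muLiu ι₁ GramClass.rep)) (line V (repAt a) (muLiu ι₁ GramClass.rep)))).H
        (Representation.ofModule' (k := ℂ) ((liuDictionaryPin exists_isReal_hodgeModel_holds hodgePQ_independent_of_hodgeModel_holds BallQuotient.ballQuotientUniformised_holds (cmAbelianVarietyRealised_of_eigenbasis exists_isReal_hodgeModel_holds hodgePQ_independent_of_hodgeModel_holds cmAbelianVarietyEigenbasisRealised_holds) Literature.NumberTheory.Transcendental.arapura2012_cor_15_4_6_holds V (I V (repAt a) (muLiu ι₁ GramClass.rep)) (line V (repAt a) (muLiu ι₁ GramClass.rep)))).H) := by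
    rintro b rfl h
    exact bettiThetaDecomposition_of_prop413AsPrinted _ _ (prop413AsPrinted_muConj _ _ h) le_rfl ι₁
  exact main _ (repAt_fst_eq_of_fst_eq_mk V a hi) (h413 hDel F h6 V a Φ hΦ i)

end Summit.HodgeConjecture.CorCM.Lines.A3Liu418

end
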